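import Summits.QuantumFields.YangMills.Theorems.UnitScaleTiltProp7CombSymDiffL1OfR0FrameMassesT3
import Summits.QuantumFields.YangMills.Theorems.UnitScaleTiltProp7CmapTwSJointRowXT3
import Summits.QuantumFields.YangMills.Theorems.UnitScaleTiltProp7PertVarCurrencyExchange
import HarnessLib

/-!
# Route `UnitScaleTilt`, crux K1 «MinimiserStabilityRegPr» (stmt-QuantumFields-19200), route-R E′ (A′)-on-Σ, P-A2 row (β) of ✓p698006 — file «(β)-ASSEMBLY G2»:
# **THE COMB–SYM DIFFERENCE ℓ¹ IN `X`-CURRENCY (THE `hD` LETTERS)** — G1's `M₀∕KD` conclusion read through ★routeR-w4's exchange ✓`Prop7PertVarCurrencyExchange` with ★routeR-w3's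
# letter-free knit ✓`Prop7CmapTwSJointRowX.knit_arith`: `Σ_ĉ ‖C^{tw}(iD) − C^{twS}(iD)‖ ≤ 6R + 408·Pc + CD₁(L,σ)·ℓ⁻¹·Σ_b‖D b‖² + CD₂(L)·ℓ·(K_W(iD) + DIV_W(iD))`

Cell `ym3-torus` (HUMAN RULING D-0037: YM₃ on the torus is ladder rung R3 — not d = 4, not a mass gap, not Clay), width seat `ym3-torus-px16` (gen 5).  `--supports stmt-QuantumFields-19200
--as helper`; THEOREMS ONLY (0 `def`, 0 `sorry`); count-neutral.  The two displayed rows `hR0` (R0-RECURSION, px13) and `hΦc` (F3″-COMB, routeR-w6) are OPEN (both ⟸ the route-internal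
row `hMcomb`, RULING №19, XL); nothing of `hD`∕`hPA2`∕`hcoS`∕E′∕EX∕the crux is claimed.

THE PRINT.  [Balaban1985Variational] (15) p.280, (19)–(20) p.281, (44)–(48) pp.285–286, Prop. 7 p.299; [Balaban1985BackgroundPropagators] (3.3)–(3.8) pp.391–392; [Balaban1985Averaging] (89)–(92) p.31.

WHY.  ★p1 g18's assembler ✓p698006 reads the (β) row in `X`-letters (`M = Σ‖X b‖²`, the JOINT plaquette form `K_W(iX)`, px12's `DIV`); G1 (✓`Prop7CombSymDiffL1OfR0FrameMasses`) delivers it in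
px17's `M₀ = Σ‖pertVar W (e^{iD}W)‖²` ∕ `KD = CURL + DIV (pertVar)` letters plus the two open masses `R`, `Pc`.  The exchange is ★routeR-w4's (`M₀ ≤ M`, `CURL ≤ 8K + 6(64a²+8s²)M`,
`DIV(pertVar) ≤ 2DIV + 12s²M`) and the bookkeeping is ★routeR-w3's `knit_arith` at `T := 1`, `r₁ := 1`, `r₂ := 2∕L` (G1's mass block `1632·Φˢ_top + 56·Z_top` IS
`cA·M₀·ℓ⁻¹ + (cB₁·KD + cB₂·ℓ⁻²M₀)·(2∕L)·ℓ` with `cA = 1632·560L³ + 56(21+10080L³)`, `cB₁ = (1632·40L² + 56(3+720L²))·28800L⁴·(L∕2)`, `cB₂ = (…)·600000L⁴·(L∕2)`).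

WHAT IS PROVED (ns `…Theorems.Prop7CombSymDiffL1XCurrency`; T³, `SU(2)`).
* ★★★ `sum_norm_CmapTw_sub_CmapTwS_le_X` — at `RegPr F n K ε₀ W`, `D` Hermitian traceless with `‖D b‖ ≤ σ·ℓ⁻¹`, windows `10¹⁴L⁹ε₀ ≤ 1`, `0 ≤ σ`, `4·10¹¹L⁹σ ≤ 1`, displayed `hR0 hΦc`:
  `Σ_ĉ‖CmapTw W (I•D) ĉ − CmapTwS W (I•D) ĉ‖ ≤ 6R + 408Pc + CD₁·ℓ⁻¹·Σ_b‖D b‖² + CD₂·ℓ·(K_W(iD) + DIV_W(iD))`, `CD₁ CD₂` explicit L∕σ-only.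
HONEST SCOPE.  Bookkeeping; the `∀ L ∃ eD CD₁ CD₂` packaging into ✓p698006's `hD` (G3) waits for the two suppliers' member theorems.

References: T. Bałaban, CMP **102** (1985) 277–309 [Balaban1985Variational] ((15) p.280, (19)–(20) p.281, (44)–(48) pp.285–286, Prop. 7 p.299); CMP **99** (1985) 389–434
[Balaban1985BackgroundPropagators] ((3.3)–(3.8) pp.391–392); CMP **98** (1985) 17–51 [Balaban1985Averaging] ((89)–(92) p.31, (97) p.32).
-/

set_option autoImplicit false

noncomputable section

open scoped BigOperators Matrix.Norms.L2Operator Matrix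

namespace Summit.QuantumFields.YangMills.Theorems.Prop7CombSymDiffL1XCurrency

open NormedSpace Finset
open Literature.MathematicalPhysics.QuantumFieldTheory.Balaban1983to89
open Literature.MathematicalPhysics.QuantumFieldTheory.Balaban1983to89.T3ContinuumYM3Torus
open MatrixLog (mlog)
open T3SectALandauChart (bgUnits emb15 eta pos_of_regPr)
open T3PrintedRegularMinimiser (RegPr)
open T4Continuum BlockAveraging AveragingRT ExpMeanLog BlockAveragingEMLLinearised BlockAveragingEMLLinearisedBackground
open B9Eq39Adjoint (curl divB)
open B10Eq27TorusAxialLog (unitsField toUField)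
open B9TorusCalculus (torusT)
open B7Prop1Explicit (expUnit val_expUnit)
open Summit.QuantumFields.YangMills.Theorems.Prop7TPrint (expHermField)
open Summit.QuantumFields.YangMills.Theorems.Prop7SymAvgTw (frameTw CmapTw)
open Summit.QuantumFields.YangMills.Theorems.Prop7SymAvgTwSym (frameTwS CmapTwS)
open Summit.QuantumFields.YangMills.Theorems.Prop7CombSymDiffL1OfR0FrameMasses (sum_norm_CmapTw_sub_CmapTwS_le_of_R0_combFrameMass)
open Summit.QuantumFields.YangMills.Theorems.Prop7CmapTwSJointRowX (knit_arith)
open Summit.QuantumFields.YangMills.Theorems.Prop7PertVarCurrencyExchange (sum_normSq_pertVar_le curlHS_pertVar_le_plaqK divHS_pertVar_le)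
open Summit.QuantumFields.YangMills.Theorems.Prop7TwistedLevelMassOfRegPr (plaq_le_of_regPr)
open Summit.QuantumFields.YangMills.Theorems.Prop7Chart48SymUntwisted (unitsField_toUField_emb15_expHermField)

variable (F : T3Family) (n K : ℕ)

set_option maxHeartbeats 400000 in
-- HEARTBEAT rule (README): the statement carries the JOINT plaquette form and the two (n3) mass blocks; `knit_arith`'s 30-argument instantiation against them measured > 200k in the sibling (S) file.
/-- ★★★ **THE (β) DIFFERENCE ROW IN `X`-CURRENCY**: at `RegPr F n K ε₀ W`, `D` bondwise Hermitian traceless with `‖D b‖ ≤ σ·(L^{K−n})⁻¹`, windows `10¹⁴L⁹ε₀ ≤ 1`, `0 ≤ σ`,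
`4·10¹¹L⁹σ ≤ 1`, and the two DISPLAYED `hMcomb`-rows `hR0` (R0-RECURSION, summed) and `hΦc` (comb inverse accumulated-frame mass):
`Σ_ĉ ‖C^{tw}_W(iD)(ĉ) − C^{twS}_W(iD)(ĉ)‖ ≤ 6R + 408Pc + CD₁·(L^{K−n})⁻¹·Σ_b‖D b‖² + CD₂·L^{K−n}·(K_W(iD) + DIV_W(iD))` — G1 ∘ ★routeR-w4's exchange ∘ ★routeR-w3's `knit_arith`.
[cite: Balaban1985Variational, (15) p.280, (19)-(20) p.281, (44)-(48) pp.285-286, Prop. 7 p.299; Balaban1985BackgroundPropagators, (3.3)-(3.8) pp.391-392; Balaban1985Averaging, (89)-(92) p.31] -/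
theorem sum_norm_CmapTw_sub_CmapTwS_le_X (h : n ≤ K) {ε₀ σ : ℝ}
    (hWε : 100000000000000 * (F.L : ℝ) ^ 9 * ε₀ ≤ 1) (hσ0 : 0 ≤ σ) (hσL : 400000000000 * (F.L : ℝ) ^ 9 * σ ≤ 1)
    (W : GaugeField (F.P K) 0 (Matrix.specialUnitaryGroup (Fin 2) ℂ)) (hreg : RegPr F n K ε₀ W)
    (D : PBond (F.P K) 0 → Matrix (Fin 2) (Fin 2) ℂ) (hD : ∀ b : PBond (F.P K) 0, (D b).IsHermitian ∧ Matrix.trace (D b) = 0)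
    (hs : ∀ b : PBond (F.P K) 0, ‖D b‖ ≤ σ * ((F.L : ℝ) ^ (K - n))⁻¹)
    {R Pc : ℝ}
    (hR0 : ∑ y : Site (F.P n) 0, ‖mlog ((((frameTw F n K h W (fun b => Complex.I • D b) y)⁻¹ * frameTwS F n K h W (fun b => Complex.I • D b) y : (Matrix (Fin 2) (Fin 2) ℂ)ˣ) : Matrix (Fin 2) (Fin 2) ℂ))
          - (fderiv ℂ (fun A : PBond (F.P K) 0 → Matrix (Fin 2) (Fin 2) ℂ => ((frameTwS F n K h W A y : (Matrix (Fin 2) (Fin 2) ℂ)ˣ) : Matrix (Fin 2) (Fin 2) ℂ)) 0 (fun b => Complex.I • D b)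
              - fderiv ℂ (fun A : PBond (F.P K) 0 → Matrix (Fin 2) (Fin 2) ℂ => ((frameTw F n K h W A y : (Matrix (Fin 2) (Fin 2) ℂ)ˣ) : Matrix (Fin 2) (Fin 2) ℂ)) 0 (fun b => Complex.I • D b))‖ ≤ R)
    (hΦc : ∑ y : Site (F.P n) 0, ‖(((frameTw F n K h W (fun b => Complex.I • D b) y)⁻¹ : (Matrix (Fin 2) (Fin 2) ℂ)ˣ) : Matrix (Fin 2) (Fin 2) ℂ) - 1‖ ^ 2 ≤ Pc) :
    ∑ c : PBond (F.P n) 0, ‖CmapTw F n K h W (fun b => Complex.I • D b) c - CmapTwS F n K h W (fun b => Complex.I • D b) c‖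
      ≤ 6 * R + 408 * Pc
        + (1 * (2 * (F.L : ℝ) * (1632 * 560 * (F.L : ℝ) ^ 3 + 56 * (21 + 10080 * (F.L : ℝ) ^ 3)) +
            2 / (F.L : ℝ) * (((1632 * (40 * (F.L : ℝ) ^ 2) + 56 * (3 + 720 * (F.L : ℝ) ^ 2)) * (28800 * (F.L : ℝ) ^ 4) * ((F.L : ℝ) / 2)) * (384 + 60 * σ ^ 2)
              + (1632 * (40 * (F.L : ℝ) ^ 2) + 56 * (3 + 720 * (F.L : ℝ) ^ 2)) * (600000 * (F.L : ℝ) ^ 4) * ((F.L : ℝ) / 2))))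
          * ((F.L : ℝ) ^ (K - n))⁻¹ * (∑ b : PBond (F.P K) 0, ‖D b‖ ^ 2)
        + (1 * (2 / (F.L : ℝ) * (8 * ((1632 * (40 * (F.L : ℝ) ^ 2) + 56 * (3 + 720 * (F.L : ℝ) ^ 2)) * (28800 * (F.L : ℝ) ^ 4) * ((F.L : ℝ) / 2))))) * (F.L : ℝ) ^ (K - n) *
          ((∑ p : Plaq (F.P K) 0, ‖((Complex.I • D ⟨p.src, p.μ⟩)
              + ((W ⟨p.src, p.μ⟩ : Matrix (Fin 2) (Fin 2) ℂ) * (Complex.I • D ⟨p.src.shift p.μ, p.ν⟩) * star (W ⟨p.src, p.μ⟩ : Matrix (Fin 2) (Fin 2) ℂ))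
              - (((W ⟨p.src, p.μ⟩ * W ⟨p.src.shift p.μ, p.ν⟩ * (W ⟨p.src.shift p.ν, p.μ⟩)⁻¹ : Matrix.specialUnitaryGroup (Fin 2) ℂ) : Matrix (Fin 2) (Fin 2) ℂ)
                  * (Complex.I • D ⟨p.src.shift p.ν, p.μ⟩)
                  * star ((W ⟨p.src, p.μ⟩ * W ⟨p.src.shift p.μ, p.ν⟩ * (W ⟨p.src.shift p.ν, p.μ⟩)⁻¹ : Matrix.specialUnitaryGroup (Fin 2) ℂ) : Matrix (Fin 2) (Fin 2) ℂ))
              - (((GaugeField.plaqHol W p : Matrix.specialUnitaryGroup (Fin 2) ℂ) : Matrix (Fin 2) (Fin 2) ℂ) * (Complex.I • D ⟨p.src, p.ν⟩)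
                  * star ((GaugeField.plaqHol W p : Matrix.specialUnitaryGroup (Fin 2) ℂ) : Matrix (Fin 2) (Fin 2) ℂ)))‖ ^ 2) +
            (∑ x : Site (F.P K) 0, ∑ j : Fin 2, ∑ k : Fin 2,
              ‖(divB (torusT (F.P K) 0) (fun κ z => unitsField (toUField W) ⟨z, κ⟩) (fun κ z => Complex.I • D ⟨z, κ⟩) x) j k‖ ^ 2)) := by
  have hε₀ : 0 < ε₀ := pos_of_regPr F hreg
  have hL3 : (3 : ℝ) ≤ (F.L : ℝ) := Prop7CurvedLandauKnitT3.three_le_L F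
  have hL1 : (1 : ℝ) ≤ (F.L : ℝ) := by linarith
  have hL0 : (0 : ℝ) < (F.L : ℝ) := by linarith
  have hℓ1 : (1 : ℝ) ≤ (F.L : ℝ) ^ (K - n) := one_le_pow₀ hL1
  have hℓ0 : (0 : ℝ) < (F.L : ℝ) ^ (K - n) := by positivity
  -- the (n3)-currency sup data `s := σ·ℓ⁻¹`
  have hs0 : 0 ≤ σ * ((F.L : ℝ) ^ (K - n))⁻¹ := by positivity
  have hs4 : 4 * (σ * ((F.L : ℝ) ^ (K - n))⁻¹) ≤ 1 := by
    have hu1 : ((F.L : ℝ) ^ (K - n))⁻¹ ≤ 1 := inv_le_one_of_one_le₀ hℓ1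
    have h1 : σ * ((F.L : ℝ) ^ (K - n))⁻¹ ≤ σ := by nlinarith
    have h9 : (1 : ℝ) ≤ (F.L : ℝ) ^ 9 := one_le_pow₀ hL1
    nlinarith
  have hsL : 400000000000 * (F.L : ℝ) ^ 9 * (((F.L : ℝ) ^ (K - n)) * (σ * ((F.L : ℝ) ^ (K - n))⁻¹)) ≤ 1 := by
    rw [show (F.L : ℝ) ^ (K - n) * (σ * ((F.L : ℝ) ^ (K - n))⁻¹) = σ by field_simp]
    exact hσL
  -- G1 at this datum
  have hG1 := sum_norm_CmapTw_sub_CmapTwS_le_of_R0_combFrameMass F n K h hε₀ hWε hs0 hs4 hsL hreg D hD hs hR0 hΦc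
  -- the currency exchange (★routeR-w4)
  have hcomp := unitsField_toUField_emb15_expHermField F W D hD
  have hU : ∀ b : PBond (F.P K) 0, ((emb15 W (expHermField D) b : Matrix.specialUnitaryGroup (Fin 2) ℂ) : Matrix (Fin 2) (Fin 2) ℂ) =
      exp (Complex.I • D b) * ((W b : Matrix.specialUnitaryGroup (Fin 2) ℂ) : Matrix (Fin 2) (Fin 2) ℂ) := by
    intro b
    have h1 := congrArg (fun u : (Matrix (Fin 2) (Fin 2) ℂ)ˣ => (u : Matrix (Fin 2) (Fin 2) ℂ)) (congrFun hcomp b)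
    simp only [Units.val_mul, val_expUnit] at h1
    exact h1
  have hX : ∀ b : PBond (F.P K) 0, (D b).IsHermitian := fun b => (hD b).1
  have hM₀ := sum_normSq_pertVar_le W (emb15 W (expHermField D)) D hX hU
  have ha := plaq_le_of_regPr F n K hreg
  have hCU := curlHS_pertVar_le_plaqK W (emb15 W (expHermField D)) D hX hU hs ha
  have hDV := divHS_pertVar_le W (emb15 W (expHermField D)) D hX hU hs
  have hε₀1 : ε₀ ≤ 1 := by
    have h9 : (1 : ℝ) ≤ (F.L : ℝ) ^ 9 := one_le_pow₀ hL1
    nlinarith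
  have hd : ((F.P K).d : ℝ) = 3 := by rw [T3Family.P_d F K]; norm_num
  have hCU0 : 0 ≤ ∑ x : Site (F.P K) 0, ∑ μ : Fin (F.P K).d, ∑ ν : Fin (F.P K).d,
      (if μ < ν then ∑ j : Fin 2, ∑ k : Fin 2,
        ‖(curl (torusT (F.P K) 0) (fun κ z => unitsField (toUField W) ⟨z, κ⟩) (fun κ z => pertVar W (emb15 W (expHermField D)) ⟨z, κ⟩) μ ν x) j k‖ ^ 2 else 0) := by
    refine sum_nonneg fun x _ => sum_nonneg fun μ _ => sum_nonneg fun ν _ => ?_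
    split_ifs
    · positivity
    · exact le_rfl
  have hPc0 : 0 ≤ Pc := le_trans (Finset.sum_nonneg fun _ _ => sq_nonneg _) hΦc
  have hR0' : 0 ≤ R := le_trans (Finset.sum_nonneg fun _ _ => norm_nonneg _) hR0
  -- G1's mass block rewritten in `knit_arith`'s shape (`T := 1`, `r₁ := 1`, `r₂ := 2∕L`)
  have hshape : ∀ (M₀ KD Λ : ℝ),
      Λ ≤ 6 * R + 408 * Pc
        + 1632 * (2 * (F.L : ℝ) * (40 * (F.L : ℝ) ^ 2) * (7 * M₀ * ((F.L : ℝ) ^ (K - n))⁻¹)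
          + 40 * (F.L : ℝ) ^ 2 * ((28800 * (F.L : ℝ) ^ 4 * KD + 600000 * (F.L : ℝ) ^ 4 * (((F.L : ℝ) ^ (K - n)) ^ 2)⁻¹ * M₀) * (F.L : ℝ) ^ (K - n)))
        + 56 * ((21 + 10080 * (F.L : ℝ) ^ 3) * (M₀ * ((F.L : ℝ) ^ (K - n))⁻¹)
          + (3 + 720 * (F.L : ℝ) ^ 2) * ((28800 * (F.L : ℝ) ^ 4 * KD + 600000 * (F.L : ℝ) ^ 4 * (((F.L : ℝ) ^ (K - n)) ^ 2)⁻¹ * M₀) * (F.L : ℝ) ^ (K - n))) →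
      Λ - 6 * R - 408 * Pc
        ≤ 1 * ((1632 * 560 * (F.L : ℝ) ^ 3 + 56 * (21 + 10080 * (F.L : ℝ) ^ 3)) * M₀ * 1 * ((F.L : ℝ) ^ (K - n))⁻¹
          + (((1632 * (40 * (F.L : ℝ) ^ 2) + 56 * (3 + 720 * (F.L : ℝ) ^ 2)) * (28800 * (F.L : ℝ) ^ 4) * ((F.L : ℝ) / 2)) * KD
              + ((1632 * (40 * (F.L : ℝ) ^ 2) + 56 * (3 + 720 * (F.L : ℝ) ^ 2)) * (600000 * (F.L : ℝ) ^ 4) * ((F.L : ℝ) / 2)) * 1 * (((F.L : ℝ) ^ (K - n)) ^ 2)⁻¹ * M₀)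
            * (2 / (F.L : ℝ)) * (F.L : ℝ) ^ (K - n)) := by
    intro M₀ KD Λ hΛ
    have e : 1632 * (2 * (F.L : ℝ) * (40 * (F.L : ℝ) ^ 2) * (7 * M₀ * ((F.L : ℝ) ^ (K - n))⁻¹)
          + 40 * (F.L : ℝ) ^ 2 * ((28800 * (F.L : ℝ) ^ 4 * KD + 600000 * (F.L : ℝ) ^ 4 * (((F.L : ℝ) ^ (K - n)) ^ 2)⁻¹ * M₀) * (F.L : ℝ) ^ (K - n)))
        + 56 * ((21 + 10080 * (F.L : ℝ) ^ 3) * (M₀ * ((F.L : ℝ) ^ (K - n))⁻¹)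
          + (3 + 720 * (F.L : ℝ) ^ 2) * ((28800 * (F.L : ℝ) ^ 4 * KD + 600000 * (F.L : ℝ) ^ 4 * (((F.L : ℝ) ^ (K - n)) ^ 2)⁻¹ * M₀) * (F.L : ℝ) ^ (K - n)))
      = 1 * ((1632 * 560 * (F.L : ℝ) ^ 3 + 56 * (21 + 10080 * (F.L : ℝ) ^ 3)) * M₀ * 1 * ((F.L : ℝ) ^ (K - n))⁻¹
          + (((1632 * (40 * (F.L : ℝ) ^ 2) + 56 * (3 + 720 * (F.L : ℝ) ^ 2)) * (28800 * (F.L : ℝ) ^ 4) * ((F.L : ℝ) / 2)) * KD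
              + ((1632 * (40 * (F.L : ℝ) ^ 2) + 56 * (3 + 720 * (F.L : ℝ) ^ 2)) * (600000 * (F.L : ℝ) ^ 4) * ((F.L : ℝ) / 2)) * 1 * (((F.L : ℝ) ^ (K - n)) ^ 2)⁻¹ * M₀)
            * (2 / (F.L : ℝ)) * (F.L : ℝ) ^ (K - n)) := by
      field_simp
      ring
    linarith [hΛ, e.le, e.ge]
  have hS := hshape _ _ _ hG1
  have hr₂0 : (0 : ℝ) ≤ 2 / (F.L : ℝ) := by positivity
  have hk := knit_arith (T := 1) (r₁ := 1) (r₂ := 2 / (F.L : ℝ))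
    hL3 hℓ0 hℓ1 rfl (by norm_num) hε₀.le hε₀1 (by positivity) (by positivity) hM₀
    (by positivity) (by positivity) (by positivity) (by positivity) (by positivity) (by norm_num) (by linarith) hr₂0 le_rfl
    (by norm_num : ((2 : ℕ) : ℝ) = 2) hd (by rw [inv_pow]) rfl hCU0 hCU (by positivity) hDV hS
  linarith [hk]

end Summit.QuantumFields.YangMills.Theorems.Prop7CombSymDiffL1XCurrency

end
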